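import Literature.NumberTheory.Weil1964.LocalBinaryGaussIntegral
import HarnessLib

/-!
# The norm balls `M_ν = {z : x² - a y² ∈ 𝔭^ν}` of `F(√a) ≅ F × F` are large lattices

Topic `NumberTheory/Weil1964`; namespace `Literature.NumberTheory.Weil1964`. KERNEL mathematics only
(plumbing definitions with bodies + theorems; no named fact, no `axiom`, no `sorry`). Sequel of
`LocalBinaryGaussIntegral.lean`; the geometric input of Weil's integration along the fibres of the norm
([Weil1964], Chap. II n° 28, proof of Prop. 4, p. 175: "l'ensemble `M_r` des `z` tels que `n(z) ∈ 𝔭^r` est un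
idéal, donc un réseau, aussi grand qu'on veut si on a pris `r` assez grand"), transplanted from the quaternion
algebra to the quadratic field `E = F(√a)`, `a` a NON-SQUARE of the non-archimedean local field `F`:

* §1 ANISOTROPY of the norm form `N(x, y) = x² - a y²`: `κ · max(‖x²‖, ‖a y²‖) ≤ ‖x² - a y²‖` for a constant
  `κ > 0` (ultrametric inequality off the diagonal `‖x²‖ = ‖ay²‖`; on it, `‖1 - a u²‖` is bounded below on the
  compact set `‖a u²‖ = 1` because `a` is not a square);
* §2 the norm balls `normBall a ν = {z : N(z) ∈ 𝔭^ν}` contain the boxes `𝔭^m × 𝔭^m` with `2m ≥ ν`, `v_a + 2m ≥ ν`,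
  are contained in a box `𝔭^{m'} × 𝔭^{m'}` with `2m' + K ≤ ν` (`K` the anisotropy exponent), are compact, and are
  stable under translation by `𝔭^ℓ × 𝔭^ℓ` for `ℓ` explicit — i.e. they are lattices, as large as we please;
* §3 hence, by the lattice independence of `LocalBinaryGaussIntegral.lean`, Weil's Gauss integrals of the binary
  form `b N = b x² ⊕ (-ab) y²` over the norm balls stabilise at `g(b) g(-ab)`:
  `∃ ν₀, ∀ ν ≤ ν₀, gaussBox ψ μ b (-ab) (normBall a ν) = weilGauss b · weilGauss (-ab)`.

NOT here: the fibre integration itself (`∫_E Φ(N z) dz = κ' ∫_{N(Eˣ)} Φ`) and the sign of `γ` on non-norms.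

## References

* [Weil1964] A. Weil, *Sur certains groupes d'opérateurs unitaires*, Acta Math. 111 (1964) 143–211, Chap. II
  n° 27 (pp. 174–175), n° 28 (pp. 175–176).
-/

set_option autoImplicit false

noncomputable section

open MeasureTheory ValuativeRel Filter Topology Set
open scoped NNReal ENNReal Pointwise
open Literature.NumberTheory.GaloisRepresentations.IsNonarchimedeanLocalField
open Literature.NumberTheory.Automorphic

namespace Literature.NumberTheory.Weil1964

variable {F : Type*} [Field F] [ValuativeRel F] [TopologicalSpace F] [IsNonarchimedeanLocalField F]

/-! ## §0 The norm form and the norm balls -/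

section Defs

/-- the **norm form** `N(x, y) = x² - a y²` of `F(√a) = F ⊕ F√a` in the coordinates `(x, y)`.
[cite: Weil1964, Chap. II n° 28, p. 175] -/
def normForm (a : F) (z : F × F) : F := z.1 ^ 2 - a * z.2 ^ 2

omit [ValuativeRel F] [TopologicalSpace F] [IsNonarchimedeanLocalField F] in
/-- unfolding. [cite: Weil1964, Chap. II n° 28, p. 175] -/
theorem normForm_apply (a : F) (z : F × F) : normForm a z = z.1 ^ 2 - a * z.2 ^ 2 := rfl

/-- **Weil's norm balls** `M_ν = {z : N(z) ∈ 𝔭^ν}`. [cite: Weil1964, Chap. II n° 28, p. 175] -/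
def normBall (a : F) (ν : ℤ) : Set (F × F) := {z | normForm a z ∈ primePowBall F ν}

/-- membership. [cite: Weil1964, Chap. II n° 28, p. 175] -/
theorem mem_normBall_iff {a : F} {ν : ℤ} {z : F × F} : z ∈ normBall a ν ↔ z.1 ^ 2 - a * z.2 ^ 2 ∈ primePowBall F ν :=
  Iff.rfl

omit [ValuativeRel F] [IsNonarchimedeanLocalField F] in
/-- the norm form is continuous. [cite: Weil1964, Chap. II n° 28, p. 175] -/
theorem continuous_normForm [IsTopologicalRing F] (a : F) : Continuous (normForm a) :=
  (continuous_fst.pow 2).sub (continuous_const.mul (continuous_snd.pow 2))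

/-- the norm balls are closed. [cite: Weil1964, Chap. II n° 28, p. 175] -/
theorem isClosed_normBall (a : F) (ν : ℤ) : IsClosed (normBall a ν) :=
  (isClosed_primePowBall ν).preimage (continuous_normForm a)

end Defs

/-! ## §1 Anisotropy of the norm form of a non-square -/

section Anisotropy

/-- **anisotropy**: for `a` not a square there is `κ ∈ (0, 1]` with `κ · max(‖x²‖, ‖a y²‖) ≤ ‖x² - a y²‖` for all
`x, y` — the norm form of the field `F(√a)` does not represent `0`, quantitatively (compactness of the set
`‖a u²‖ = 1`). [cite: Weil1964, Chap. II n° 28, p. 175] -/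
theorem exists_anisotropy_const {a : F} (ha : ¬ IsSquare a) :
    ∃ κ : ℝ≥0, 0 < κ ∧ κ ≤ 1 ∧
      ∀ x y : F, κ * max (normAbs F (x ^ 2)) (normAbs F (a * y ^ 2)) ≤ normAbs F (x ^ 2 - a * y ^ 2) := by
  -- the compact set `S = {u : ‖a u²‖ = 1}` and the positive continuous function `f(u) = ‖1 - a u²‖` on it
  set S : Set F := {u | normAbs F (a * u ^ 2) = 1} with hSdef
  set f : F → ℝ≥0 := fun u => normAbs F (1 - a * u ^ 2) with hfdef
  have hfc : Continuous f :=
    LocalFieldHaar.continuous_normAbs.comp (continuous_const.sub (continuous_const.mul (continuous_id.pow 2)))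
  have hfpos : ∀ u ∈ S, 0 < f u := by
    intro u hu
    rw [hfdef]
    refine pos_iff_ne_zero.2 fun h0 => ha ?_
    have h1 : 1 - a * u ^ 2 = 0 := (map_eq_zero (normAbs F)).1 h0
    have hu0 : u ≠ 0 := by
      rintro rfl
      rw [hSdef, Set.mem_setOf_eq] at hu
      simp at hu
    exact ⟨u⁻¹, by field_simp; linear_combination -h1⟩
  have hSc : IsCompact S := by
    by_cases hne : S.Nonempty
    · obtain ⟨u₀, hu₀⟩ := hne
      obtain ⟨k₀, hk₀⟩ := exists_mem_primePowBall u₀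
      refine (isCompact_primePowBall k₀).of_isClosed_subset
        (isClosed_eq (LocalFieldHaar.continuous_normAbs.comp (continuous_const.mul (continuous_id.pow 2)))
          continuous_const) fun u hu => ?_
      -- `‖u‖² = ‖u₀‖²`, hence `‖u‖ = ‖u₀‖`
      have ha0 : normAbs F a ≠ 0 := by
        intro h
        rw [hSdef, Set.mem_setOf_eq, map_mul, h, zero_mul] at hu₀
        exact zero_ne_one hu₀
      have hsq : normAbs F u ^ 2 = normAbs F u₀ ^ 2 := by
        rw [hSdef, Set.mem_setOf_eq, map_mul, map_pow] at hu hu₀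
        exact mul_left_cancel₀ ha0 (hu.trans hu₀.symm)
      have heq : normAbs F u = normAbs F u₀ := le_antisymm
        ((pow_le_pow_iff_left₀ zero_le zero_le two_ne_zero).1 hsq.le)
        ((pow_le_pow_iff_left₀ zero_le zero_le two_ne_zero).1 hsq.ge)
      rw [mem_primePowBall_iff, heq]
      exact hk₀
    · rw [Set.not_nonempty_iff_eq_empty.1 hne]
      exact isCompact_empty
  -- the positive lower bound of `f` on `S`
  have key : ∃ κ : ℝ≥0, 0 < κ ∧ κ ≤ 1 ∧ ∀ u ∈ S, κ ≤ f u := by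
    by_cases hne : S.Nonempty
    · obtain ⟨u₀, hu₀, hmin⟩ := hSc.exists_isMinOn hne hfc.continuousOn
      exact ⟨min (f u₀) 1, lt_min (hfpos u₀ hu₀) one_pos, min_le_right _ _,
        fun u hu => (min_le_left _ _).trans (hmin hu)⟩
    · exact ⟨1, one_pos, le_rfl, fun u hu => (hne ⟨u, hu⟩).elim⟩
  obtain ⟨κ, hκ0, hκ1, hκ⟩ := key
  refine ⟨κ, hκ0, hκ1, fun x y => ?_⟩
  rcases lt_trichotomy (normAbs F (x ^ 2)) (normAbs F (a * y ^ 2)) with hlt | heq | hgt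
  · -- `‖x²‖ < ‖ay²‖`: the difference has norm `‖ay²‖`
    have h1 : normAbs F (x ^ 2 - a * y ^ 2) = normAbs F (a * y ^ 2) := by
      rw [show x ^ 2 - a * y ^ 2 = -(a * y ^ 2) + x ^ 2 by ring,
        LocalFieldHaar.normAbs_add_eq_of_lt (by rwa [normAbs_neg]), normAbs_neg]
    rw [h1, max_eq_right hlt.le]
    exact mul_le_of_le_one_left zero_le hκ1
  · -- the diagonal case
    by_cases hx : x = 0
    · subst hx
      have h0 : normAbs F (a * y ^ 2) = 0 := by rw [← heq]; simp
      rw [h0, show normAbs F ((0 : F) ^ 2) = 0 by simp, max_self, mul_zero]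
      exact zero_le
    · have hx2 : x ^ 2 ≠ 0 := pow_ne_zero 2 hx
      set u : F := y / x with hudef
      have huS : u ∈ S := by
        rw [hSdef, Set.mem_setOf_eq, hudef, show a * (y / x) ^ 2 = a * y ^ 2 / x ^ 2 by rw [div_pow]; ring,
          map_div₀, ← heq, div_self ((map_ne_zero _).2 hx2)]
      have hfac : x ^ 2 - a * y ^ 2 = x ^ 2 * (1 - a * u ^ 2) := by
        rw [hudef, div_pow]; field_simp
      rw [max_eq_left heq.ge, hfac, map_mul, mul_comm κ]
      exact mul_le_mul_of_nonneg_left (hκ u huS) zero_le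
  · have h1 : normAbs F (x ^ 2 - a * y ^ 2) = normAbs F (x ^ 2) := by
      rw [sub_eq_add_neg, LocalFieldHaar.normAbs_add_eq_of_lt (by rwa [normAbs_neg])]
    rw [h1, max_eq_left hgt.le]
    exact mul_le_of_le_one_left zero_le hκ1

end Anisotropy

/-! ## §2 The norm balls are large lattices -/

section Lattice

/-- **the norm balls are bounded**: there is `K ∈ ℕ` (depending on `a` only) such that `M_ν ⊆ 𝔭^{m'} × 𝔭^{m'}`
whenever `2m' + K ≤ ν`. [cite: Weil1964, Chap. II n° 28, p. 175] -/
theorem exists_normBall_subset_primePowBox {a : F} (ha : ¬ IsSquare a) :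
    ∃ K : ℕ, ∀ ν m' : ℤ, 2 * m' + K ≤ ν → normBall a ν ⊆ primePowBox F m' := by
  have ha0 : a ≠ 0 := fun h => ha (h ▸ IsSquare.zero)
  obtain ⟨κ, hκ0, -, hκ⟩ := exists_anisotropy_const ha
  set r : ℝ≥0 := (residueFieldCard F : ℝ≥0)⁻¹ with hrdef
  have hr0 : 0 < r := inv_residueFieldCard_pos
  have hr1 : r < 1 := inv_residueFieldCard_lt_one
  have hκa : 0 < κ * normAbs F a := mul_pos hκ0 (pos_iff_ne_zero.2 ((map_ne_zero _).2 ha0))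
  obtain ⟨n₁, hn₁⟩ := NNReal.exists_pow_lt_of_lt_one hκ0 hr1
  obtain ⟨n₂, hn₂⟩ := NNReal.exists_pow_lt_of_lt_one hκa hr1
  refine ⟨max n₁ n₂, fun ν m' hνm z hz => ?_⟩
  set K : ℕ := max n₁ n₂ with hKdef
  have hK₁ : r ^ K ≤ κ := (pow_le_pow_right_of_le_one' hr1.le (le_max_left n₁ n₂)).trans hn₁.le
  have hK₂ : r ^ K ≤ κ * normAbs F a := (pow_le_pow_right_of_le_one' hr1.le (le_max_right n₁ n₂)).trans hn₂.le
  rw [mem_normBall_iff, mem_primePowBall_iff] at hz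
  have hmax := (hκ z.1 z.2).trans hz
  have hrK : (0 : ℝ≥0) < r ^ K := pow_pos hr0 K
  -- the exponent comparison `r^{ν - K} ≤ (r^{m'})²`
  have hexp : r ^ ν / r ^ K ≤ (r ^ m') ^ 2 := by
    rw [← zpow_natCast, ← zpow_sub₀ hr0.ne', ← zpow_natCast, ← zpow_mul]
    exact inv_residueFieldCard_zpow_le_iff.2 (by push_cast; omega)
  rw [mem_primePowBox_iff, mem_primePowBall_iff, mem_primePowBall_iff]
  constructor
  · have h1 : κ * normAbs F (z.1 ^ 2) ≤ r ^ ν := (mul_le_mul_of_nonneg_left (le_max_left _ _) zero_le).trans hmax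
    have h2 : normAbs F z.1 ^ 2 * r ^ K ≤ r ^ ν := by
      rw [← map_pow]
      calc normAbs F (z.1 ^ 2) * r ^ K ≤ normAbs F (z.1 ^ 2) * κ := mul_le_mul_of_nonneg_left hK₁ zero_le
        _ = κ * normAbs F (z.1 ^ 2) := mul_comm _ _
        _ ≤ r ^ ν := h1
    have h3 : normAbs F z.1 ^ 2 ≤ (r ^ m') ^ 2 := ((le_div_iff₀ hrK).2 h2).trans hexp
    exact (pow_le_pow_iff_left₀ zero_le zero_le two_ne_zero).1 h3
  · have h1 : κ * normAbs F (a * z.2 ^ 2) ≤ r ^ ν := (mul_le_mul_of_nonneg_left (le_max_right _ _) zero_le).trans hmax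
    have h2 : normAbs F z.2 ^ 2 * r ^ K ≤ r ^ ν := by
      calc normAbs F z.2 ^ 2 * r ^ K ≤ normAbs F z.2 ^ 2 * (κ * normAbs F a) := mul_le_mul_of_nonneg_left hK₂ zero_le
        _ = κ * normAbs F (a * z.2 ^ 2) := by rw [map_mul, map_pow]; ring
        _ ≤ r ^ ν := h1
    have h3 : normAbs F z.2 ^ 2 ≤ (r ^ m') ^ 2 := ((le_div_iff₀ hrK).2 h2).trans hexp
    exact (pow_le_pow_iff_left₀ zero_le zero_le two_ne_zero).1 h3

/-- **the norm balls contain large boxes**: `𝔭^m × 𝔭^m ⊆ M_ν` when `ν ≤ 2m` and `ν ≤ v_a + 2m` (`‖a‖ = q^{-v_a}`).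
[cite: Weil1964, Chap. II n° 28, p. 175] -/
theorem primePowBox_subset_normBall {a : F} {va : ℤ} (hva : normAbs F a = (residueFieldCard F : ℝ≥0)⁻¹ ^ va)
    {ν m : ℤ} (h1 : ν ≤ 2 * m) (h2 : ν ≤ va + 2 * m) : primePowBox F m ⊆ normBall a ν := by
  intro z hz
  rw [mem_primePowBox_iff] at hz
  rw [mem_normBall_iff]
  have ha : a ∈ primePowBall F va := by rw [mem_primePowBall_iff, hva]
  have hx : z.1 ^ 2 ∈ primePowBall F ν := by
    rw [pow_two]; exact primePowBall_antitone (by omega) (mul_mem_primePowBall hz.1 hz.1)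
  have hy : a * z.2 ^ 2 ∈ primePowBall F ν := by
    rw [show a * z.2 ^ 2 = a * z.2 * z.2 by ring]
    exact primePowBall_antitone (by omega) (mul_mem_primePowBall (mul_mem_primePowBall ha hz.2) hz.2)
  rw [sub_eq_add_neg]
  exact add_mem_primePowBall hx (neg_mem_primePowBall hy)

/-- **the norm balls are stable under small translations**: if `z ∈ M_ν ∩ (𝔭^{m'} × 𝔭^{m'})` and
`h ∈ 𝔭^ℓ × 𝔭^ℓ` with `ν ≤ v₂ + m' + ℓ`, `ν ≤ 2ℓ`, `ν ≤ v_a + v₂ + m' + ℓ`, `ν ≤ v_a + 2ℓ`, then `z + h ∈ M_ν`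
(`N(z + h) = N(z) + 2x h₁ + h₁² - 2a y h₂ - a h₂²`). [cite: Weil1964, Chap. II n° 28, p. 175] -/
theorem add_mem_normBall {a : F} {va v₂ : ℤ} (hva : normAbs F a = (residueFieldCard F : ℝ≥0)⁻¹ ^ va)
    (h2 : normAbs F (2 : F) = (residueFieldCard F : ℝ≥0)⁻¹ ^ v₂) {ν m' ℓ : ℤ} (hℓ₁ : ν ≤ v₂ + m' + ℓ)
    (hℓ₂ : ν ≤ 2 * ℓ) (hℓ₃ : ν ≤ va + v₂ + m' + ℓ) (hℓ₄ : ν ≤ va + 2 * ℓ) {z h : F × F} (hz : z ∈ normBall a ν)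
    (hz' : z ∈ primePowBox F m') (hh : h ∈ primePowBox F ℓ) : z + h ∈ normBall a ν := by
  rw [mem_primePowBox_iff] at hz' hh
  rw [mem_normBall_iff] at hz ⊢
  have ha : a ∈ primePowBall F va := by rw [mem_primePowBall_iff, hva]
  have htwo : (2 : F) ∈ primePowBall F v₂ := by rw [mem_primePowBall_iff, h2]
  have t1 : 2 * z.1 * h.1 ∈ primePowBall F ν :=
    primePowBall_antitone (by omega) (mul_mem_primePowBall (mul_mem_primePowBall htwo hz'.1) hh.1)
  have t2 : h.1 ^ 2 ∈ primePowBall F ν := by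
    rw [pow_two]; exact primePowBall_antitone (by omega) (mul_mem_primePowBall hh.1 hh.1)
  have t3 : a * (2 * z.2 * h.2) ∈ primePowBall F ν :=
    primePowBall_antitone (by omega)
      (mul_mem_primePowBall ha (mul_mem_primePowBall (mul_mem_primePowBall htwo hz'.2) hh.2))
  have t4 : a * h.2 ^ 2 ∈ primePowBall F ν := by
    rw [show a * h.2 ^ 2 = a * h.2 * h.2 by ring]
    exact primePowBall_antitone (by omega) (mul_mem_primePowBall (mul_mem_primePowBall ha hh.2) hh.2)
  have e : (z + h).1 ^ 2 - a * (z + h).2 ^ 2 =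
      (z.1 ^ 2 - a * z.2 ^ 2) + (2 * z.1 * h.1 + h.1 ^ 2 + (-(a * (2 * z.2 * h.2)) + -(a * h.2 ^ 2))) := by
    simp only [Prod.fst_add, Prod.snd_add]; ring
  rw [e]
  exact add_mem_primePowBall hz (add_mem_primePowBall (add_mem_primePowBall t1 t2)
    (add_mem_primePowBall (neg_mem_primePowBall t3) (neg_mem_primePowBall t4)))

/-- the norm balls of a non-square are compact. [cite: Weil1964, Chap. II n° 28, p. 175] -/
theorem isCompact_normBall {a : F} (ha : ¬ IsSquare a) (ν : ℤ) : IsCompact (normBall a ν) := by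
  obtain ⟨K, hK⟩ := exists_normBall_subset_primePowBox ha
  exact (isCompact_primePowBox ((ν - K) / 2)).of_isClosed_subset (isClosed_normBall a ν)
    (hK ν _ (by omega))

end Lattice

/-! ## §3 Gauss integrals over the norm balls -/

section Gauss

variable [MeasurableSpace F] [BorelSpace F] (μ : Measure F) [μ.IsAddHaarMeasure] {ψ : AddChar F Circle}

/-- **`g(b N, M_ν) = g(b) g(-ab)` for all `ν` small enough**: Weil's Gauss integrals of `b x² ⊕ (-ab) y²` over the
norm balls `M_ν` stabilise at the product of the one-variable stable values (the `M_r` are lattices "aussi grands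
qu'on veut", so the lattice independence of n° 27 applies). [cite: Weil1964, Chap. II n° 28, pp. 175–176] -/
theorem exists_forall_gaussBox_normBall_eq {a b : F} (hψ : ψ.IsContinuousNontrivial) (ha : ¬ IsSquare a)
    (hb : b ≠ 0) (htwo : (2 : F) ≠ 0) :
    ∃ ν₀ : ℤ, ∀ ν ≤ ν₀,
      gaussBox ψ μ b (-(a * b)) (normBall a ν) = weilGauss ψ μ b * weilGauss ψ μ (-(a * b)) := by
  have ha0 : a ≠ 0 := fun h => ha (h ▸ IsSquare.zero)
  have hab : -(a * b) ≠ 0 := neg_ne_zero.2 (mul_ne_zero ha0 hb)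
  obtain ⟨ℓ, m₀, hmℓ, hD⟩ := exists_forall_gaussBox_eq_weilGauss_mul μ hψ hb hab htwo
  obtain ⟨K, hK⟩ := exists_normBall_subset_primePowBox ha
  obtain ⟨va, hva⟩ := exists_normAbs_eq_inv_zpow ha0
  obtain ⟨v₂, hv₂⟩ := exists_normAbs_eq_inv_zpow htwo
  have hv₂0 : 0 ≤ v₂ := nonneg_of_normAbs_two_eq hv₂
  refine ⟨-(2 * (|va| + |v₂| + |ℓ| + |m₀| + (K : ℤ) + 2)), fun ν hν => ?_⟩
  -- the auxiliary box `𝔭^{m'} × 𝔭^{m'} ⊇ M_ν`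
  set m' : ℤ := (ν - K) / 2 with hm'def
  have hm'₁ : 2 * m' + K ≤ ν := by omega
  have hm'₂ : ν - K < 2 * m' + 2 := by omega
  have hsub : normBall a ν ⊆ primePowBox F m' := hK ν m' hm'₁
  refine hD (normBall a ν) (isCompact_normBall ha ν) (fun x hx h hh => ?_) ?_
  · exact add_mem_normBall hva hv₂ (ℓ := ℓ) (m' := m')
      (by cases abs_cases va <;> cases abs_cases v₂ <;> cases abs_cases ℓ <;> cases abs_cases m₀ <;> omega)
      (by cases abs_cases va <;> cases abs_cases v₂ <;> cases abs_cases ℓ <;> cases abs_cases m₀ <;> omega)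
      (by cases abs_cases va <;> cases abs_cases v₂ <;> cases abs_cases ℓ <;> cases abs_cases m₀ <;> omega)
      (by cases abs_cases va <;> cases abs_cases v₂ <;> cases abs_cases ℓ <;> cases abs_cases m₀ <;> omega)
      hx (hsub hx) hh
  · exact primePowBox_subset_normBall hva
      (by cases abs_cases va <;> cases abs_cases v₂ <;> cases abs_cases ℓ <;> cases abs_cases m₀ <;> omega)
      (by cases abs_cases va <;> cases abs_cases v₂ <;> cases abs_cases ℓ <;> cases abs_cases m₀ <;> omega)

end Gauss

end Literature.NumberTheory.Weil1964
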